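import Summits.Ventures.PercRepro.RankLevelSetRuleQSliceTwoChain
import Summits.Ventures.PercRepro.RankLevelSetRuleQSliceSecondUntrunc
import Summits.Ventures.PercRepro.RankLevelSetRuleQRhat

/-!
# PercRepro — THE CELL `m = 2` OF THE SECOND UNTRUNCATED SLICE; `u = k` ON ITS WHOLE BOTTOM REGIME (night-1, gen 21; dossier §32.3)

At `u = k`, `m = 2` (`q = k + 2`) the slice identity reads `R̂ − Φ = 1 + ρ(3k+4, k+2) − ρ(k+4, 2) − T_k(2)` with
* **`rho_second_two_ge`** — `ρ(3k+4, k+2) ≥ 7/4` for `k ≥ 5` (four terms `≥ 1/2 + 3/14 + 1/14 + 1/56`);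
* **`rho_two_le'`** — `ρ(k+4, 2) = 1 + 2(k+5)/((k+3)(k+4)) ≤ 23/18` for `k ≥ 5`;
* **`sliceTail_kk_two_le`** — `T_k(2) ≤ 53/36` for `k ≥ 5` by the `m = 2` chain (`P₂(k, k) = k(k+3)/((k+1)(2k+5))`, the bracket
  `≤ 9/4`, and `81(k+1)(k+2)(2k+5) ≤ 106(2k+1)(k²+4k+5)`, i.e. `50k³ + 63k² − 55k − 280 ≥ 0`);
so `T_k(2) ≤ 53/36 = 1 + 7/4 − 23/18`, and
* **`second_untrunc_two (k) (5 ≤ k) : Φ(2k+2, k+2) ≤ R̂(k+2, k, 2)`**;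
* **`second_untrunc_slice_complete (k q) (5 ≤ k) (k ≤ q) (q ≤ k² + k) : Φ(q+k, q) ≤ R̂(q, k, q − k)`** — THE SECOND UNTRUNCATED
  SLICE IS PAID ON ITS WHOLE BOTTOM REGIME `k ≤ q ≤ k² + k`, EVERY FAMILY `k ≥ 5`; `ruleQRecv_ge_phiK_second_untrunc_complete`
  is the matroid level.
Twin: mining/night-1/g21/seconduntr_m2.py. Axioms: standard.
-/

namespace PercRepro

open Set Matroid Finset

/-- **`ρ(3k+4, k+2) ≥ 7/4` for `k ≥ 5`**: the first four terms of `ρ − 1` are `(k+2)/(2k+3) ≥ 1/2`, `·(k+1)/(2k+4) ≥ ·3/7`,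
`·k/(2k+5) ≥ ·1/3`, `·(k−1)/(2k+6) ≥ ·1/4` (`k ≥ 5`), with sum `≥ 1/2 + 3/14 + 1/14 + 1/56 ≥ 3/4`. -/
lemma rho_second_two_ge (k : ℕ) (hk : 5 ≤ k) :
    (7 : ℚ) / 4 ≤ (∑ i ∈ range (2 + k + 1), ((2 * (2 + k) + k).choose i : ℚ)) / ((2 * (2 + k) + k).choose (2 + k) : ℚ) := by
  rw [rho_as_prod_sum (2 * (2 + k) + k) (2 + k) (by omega)]
  have hsub : ∑ s ∈ range 5, ∏ t ∈ range s, ((((2 + k : ℕ) : ℚ) - t) / (((2 * (2 + k) + k : ℕ) : ℚ) - ((2 + k : ℕ) : ℚ) + 1 + t))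
      ≤ ∑ s ∈ range (2 + k + 1), ∏ t ∈ range s, ((((2 + k : ℕ) : ℚ) - t) / (((2 * (2 + k) + k : ℕ) : ℚ) - ((2 + k : ℕ) : ℚ) + 1 + t)) := by
    apply Finset.sum_le_sum_of_subset_of_nonneg (Finset.range_mono (by omega))
    intro s hs _
    rw [Finset.mem_range] at hs
    apply Finset.prod_nonneg
    intro t ht
    rw [Finset.mem_range] at ht
    have ht0 : (0 : ℚ) ≤ t := by positivity
    apply div_nonneg
    · push_cast
      have : (t : ℚ) ≤ 2 + (k : ℚ) := by exact_mod_cast (by omega : t ≤ 2 + k)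
      linarith
    · push_cast; linarith
  refine le_trans ?_ hsub
  simp only [Finset.sum_range_succ, Finset.sum_range_zero, Finset.prod_range_succ, Finset.prod_range_zero]
  push_cast
  have hk' : (5 : ℚ) ≤ k := by exact_mod_cast hk
  have f1 : (1 : ℚ) / 2 ≤ (2 + (k : ℚ) - 0) / (2 * (2 + k) + k - (2 + k) + 1 + 0) := by
    rw [div_le_div_iff₀ (by norm_num) (by linarith)]; linarith
  have f2 : (3 : ℚ) / 7 ≤ (2 + (k : ℚ) - 1) / (2 * (2 + k) + k - (2 + k) + 1 + 1) := by
    rw [div_le_div_iff₀ (by norm_num) (by linarith)]; linarith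
  have f3 : (1 : ℚ) / 3 ≤ (2 + (k : ℚ) - 2) / (2 * (2 + k) + k - (2 + k) + 1 + 2) := by
    rw [div_le_div_iff₀ (by norm_num) (by linarith)]; linarith
  have f4 : (1 : ℚ) / 4 ≤ (2 + (k : ℚ) - 3) / (2 * (2 + k) + k - (2 + k) + 1 + 3) := by
    rw [div_le_div_iff₀ (by norm_num) (by linarith)]; linarith
  have g1 : (0 : ℚ) ≤ (2 + (k : ℚ) - 0) / (2 * (2 + k) + k - (2 + k) + 1 + 0) := by apply div_nonneg <;> linarith
  have g2 : (0 : ℚ) ≤ (2 + (k : ℚ) - 1) / (2 * (2 + k) + k - (2 + k) + 1 + 1) := by apply div_nonneg <;> linarith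
  have g3 : (0 : ℚ) ≤ (2 + (k : ℚ) - 2) / (2 * (2 + k) + k - (2 + k) + 1 + 2) := by apply div_nonneg <;> linarith
  have h12 := mul_le_mul f1 f2 (by norm_num) g1
  have h123 := mul_le_mul h12 f3 (by norm_num) (mul_nonneg g1 g2)
  have h1234 := mul_le_mul h123 f4 (by norm_num) (mul_nonneg (mul_nonneg g1 g2) g3)
  nlinarith [h12, h123, h1234]

/-- **`ρ(k+4, 2) ≤ 23/18` for `k ≥ 5`**: `ρ(k+4, 2) = 1 + 2(k+5)/((k+3)(k+4))`. -/
lemma rho_two_le' (k : ℕ) (hk : 5 ≤ k) :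
    (∑ i ∈ range (2 + 1), ((2 * 2 + k).choose i : ℚ)) / ((2 * 2 + k).choose 2 : ℚ) ≤ 23 / 18 := by
  simp only [Finset.sum_range_succ, Finset.sum_range_zero, Nat.choose_zero_right, Nat.choose_one_right, Nat.cast_one, zero_add]
  have h := Nat.add_one_mul_choose_eq (2 * 2 + k - 1) 1
  rw [show 2 * 2 + k - 1 + 1 = 2 * 2 + k by omega, Nat.choose_one_right] at h
  have hc := congrArg (fun x : ℕ => (x : ℚ)) h
  push_cast [Nat.cast_sub (by omega : 1 ≤ 2 * 2 + k)] at hc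
  have hC : (0 : ℚ) < ((2 * 2 + k).choose 2 : ℚ) := Nat.cast_pos.mpr (Nat.choose_pos (by omega))
  have hk' : (5 : ℚ) ≤ k := by exact_mod_cast hk
  rw [div_le_iff₀ hC]
  push_cast
  -- C(k+4, 2)·2 = (k+4)(k+3); then 36(k+5) ≤ 5(k+4)(k+3) ⟺ 5k² − k − 120 ≥ 0 ⟸ k ≥ 5
  nlinarith [hc, mul_nonneg (by linarith : (0 : ℚ) ≤ (k : ℚ) - 5) (by linarith : (0 : ℚ) ≤ 5 * (k : ℚ) + 24)]

/-- **`T_k(2) ≤ 53/36` for `k ≥ 5`** by the `m = 2` chain: the bracket `1 + 2x₁ + x₁x₂ ≤ 9/4` (`x₁ = (k+1)/(2k+3) ≤ 1/2`,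
`x₂ = (k+2)/(2k+4) = 1/2`), the first factor `(k+1)(k+2)/((2k+1)(2k+2))`, and `1/(1 − P₂) = (k+1)(2k+5)/(k²+4k+5)`:
`81(k+1)(k+2)(2k+5) ≤ 106(2k+1)(k²+4k+5)`. -/
lemma sliceTail_kk_two_le (k : ℕ) (hk : 5 ≤ k) : sliceTail k k 2 ≤ 53 / 36 := by
  have hk' : (5 : ℚ) ≤ k := by exact_mod_cast hk
  have hP : twoRatio k k < 1 := by
    unfold twoRatio
    rw [div_lt_one (by positivity)]
    nlinarith
  have h := sliceTail_two_le_chain k k hP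
  rw [sliceTwoTerm_zero_eq] at h
  have x1 : ((k : ℚ) + 1) / ((k : ℚ) + k + 3) ≤ 1 / 2 := by rw [div_le_div_iff₀ (by positivity) (by norm_num)]; linarith
  have x2 : ((k : ℚ) + 2) / ((k : ℚ) + k + 4) ≤ 1 / 2 := by rw [div_le_div_iff₀ (by positivity) (by norm_num)]; linarith
  have x10 : 0 ≤ ((k : ℚ) + 1) / ((k : ℚ) + k + 3) := by positivity
  have x20 : 0 ≤ ((k : ℚ) + 2) / ((k : ℚ) + k + 4) := by positivity
  have hbr : 1 + 2 * (((k : ℚ) + 1) / ((k : ℚ) + k + 3)) + (((k : ℚ) + 1) / ((k : ℚ) + k + 3)) * (((k : ℚ) + 2) / ((k : ℚ) + k + 4))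
      ≤ 9 / 4 := by
    have h12 : ((k : ℚ) + 1) / ((k : ℚ) + k + 3) * (((k : ℚ) + 2) / ((k : ℚ) + k + 4)) ≤ (1 / 2) * (1 / 2) :=
      mul_le_mul x1 x2 x20 (by norm_num)
    nlinarith
  have hinv : 1 / (1 - twoRatio k k) = (((k : ℚ) + 1) * ((k : ℚ) + k + 5)) / ((k : ℚ) ^ 2 + 4 * k + 5) := by
    have h1 : 1 - twoRatio k k = ((k : ℚ) ^ 2 + 4 * k + 5) / (((k : ℚ) + 1) * ((k : ℚ) + k + 5)) := by
      unfold twoRatio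
      rw [eq_div_iff (by positivity), sub_mul, div_mul_cancel₀ _ (by positivity)]
      ring
    rw [h1, one_div_div]
  rw [hinv] at h
  have hR0 : 0 ≤ (((k : ℚ) + 1) * ((k : ℚ) + 2)) / (((k : ℚ) + k + 1) * ((k : ℚ) + k + 2)) := by positivity
  have hinv0 : 0 ≤ (((k : ℚ) + 1) * ((k : ℚ) + k + 5)) / ((k : ℚ) ^ 2 + 4 * k + 5) := by positivity
  have hfinal : (((k : ℚ) + 1) * ((k : ℚ) + 2)) / (((k : ℚ) + k + 1) * ((k : ℚ) + k + 2)) * (9 / 4)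
      * ((((k : ℚ) + 1) * ((k : ℚ) + k + 5)) / ((k : ℚ) ^ 2 + 4 * k + 5)) ≤ 53 / 36 := by
    rw [div_mul_eq_mul_div, div_mul_div_comm, div_le_div_iff₀ (by positivity) (by norm_num)]
    have hpoly : (0 : ℚ) ≤ 50 * (k : ℚ) ^ 3 + 63 * (k : ℚ) ^ 2 - 55 * k - 280 := by nlinarith
    nlinarith [hpoly]
  calc sliceTail k k 2
      ≤ (((k : ℚ) + 1) * ((k : ℚ) + 2)) / (((k : ℚ) + k + 1) * ((k : ℚ) + k + 2))
          * (1 + 2 * (((k : ℚ) + 1) / ((k : ℚ) + k + 3)) + (((k : ℚ) + 1) / ((k : ℚ) + k + 3)) * (((k : ℚ) + 2) / ((k : ℚ) + k + 4)))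
          * ((((k : ℚ) + 1) * ((k : ℚ) + k + 5)) / ((k : ℚ) ^ 2 + 4 * k + 5)) := h
    _ ≤ (((k : ℚ) + 1) * ((k : ℚ) + 2)) / (((k : ℚ) + k + 1) * ((k : ℚ) + k + 2)) * (9 / 4)
          * ((((k : ℚ) + 1) * ((k : ℚ) + k + 5)) / ((k : ℚ) ^ 2 + 4 * k + 5)) := by
        apply mul_le_mul_of_nonneg_right _ hinv0
        exact mul_le_mul_of_nonneg_left hbr hR0
    _ ≤ 53 / 36 := hfinal

/-- **The cell `m = 2` of the second untruncated slice, every family `k ≥ 5`**: `Φ(2k+2, k+2) ≤ R̂(k+2, k, 2)`. -/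
theorem second_untrunc_two (k : ℕ) (hk : 5 ≤ k) : phiK (k + 2 + k) (k + 2) ≤ rhat (k + 2) k 2 := by
  have h := phiK_le_rhat_of_sliceTail k k 2 (by omega) (by
    have h1 := sliceTail_kk_two_le k hk
    have h2 := rho_second_two_ge k hk
    have h3 := rho_two_le' k hk
    linarith)
  rw [show k + 2 + k = 2 + k + k by ring, show k + 2 = 2 + k by ring]
  exact h

/-- **THE SECOND UNTRUNCATED SLICE ON ITS WHOLE BOTTOM REGIME, EVERY FAMILY `k ≥ 5`**: `k ≤ q ≤ k² + k` ⇒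
`Φ(q+k, q) ≤ R̂(q, k, q − k)` (`q = k`: `rhat_zero_eq`; `q = k + 1`: `rhatCell_one`; `q = k + 2`: `second_untrunc_two`;
`q ≥ k + 3`: `second_untrunc_slice`). -/
theorem second_untrunc_slice_complete (k q : ℕ) (hk : 5 ≤ k) (hq : k ≤ q) (hq' : q ≤ k * k + k) :
    phiK (q + k) q ≤ rhat q k (q - k) := by
  rcases Nat.lt_or_ge q (k + 3) with h | h
  · rcases Nat.lt_or_ge q (k + 1) with h0 | h1
    · have : q = k := by omega
      subst this
      rw [Nat.sub_self, rhat_zero_eq _ _ (by omega)]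
    · rcases Nat.lt_or_ge q (k + 2) with h1' | h2
      · have : q = k + 1 := by omega
        subst this
        rw [show k + 1 - k = 1 by omega]
        exact rhatCell_one (k + 1) k (by omega) (by omega)
      · have : q = k + 2 := by omega
        subst this
        rw [show k + 2 - k = 2 by omega]
        exact second_untrunc_two k hk
  · exact second_untrunc_slice k q hk h hq'

/-- The matroid level of `second_untrunc_slice_complete`. -/
theorem ruleQRecv_ge_phiK_second_untrunc_complete {β : Type} (M : Matroid β) [M.Finite] {q k : ℕ} (hk : 5 ≤ k)
    (hq : k ≤ q) (hq' : q ≤ k * k + k) (hE : M.E.ncard = (q + k) + q) {Z : Set β}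
    (hZ : Z ∈ cellMembers M (q + k) q) (hP : (flatPart M Z).ncard = q - k) :
    phiK (q + k) q ≤ ruleQRecv M (q + k) q Z := by
  have h1 := second_untrunc_slice_complete k q hk hq hq'
  have h2 := rhat_le_ruleQRecv M hE hZ
  rw [hP] at h2
  exact h1.trans h2

end PercRepro
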